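import Mathlib
import HarnessLib
import Summits.NavierStokesRegularity.NavierStokesRegularity.Theorems.UnthreadedRigidityDoorUnthreadedRigidityVirialHornBracketFrame
import Summits.NavierStokesRegularity.NavierStokesRegularity.Theorems.UnthreadedRigidityDoorUnthreadedRigidityVirialHornAngularTwo
import Summits.NavierStokesRegularity.NavierStokesRegularity.Theorems.UnthreadedRigidityDoorUnthreadedRigidityVirialHornIsoOrderOneLaw
import Summits.NavierStokesRegularity.NavierStokesRegularity.Theorems.ThreadingFluxHorizonTowerZonalBridge

/-!
# Route `UnthreadedRigidityDoor`, item `UnthreadedRigidity` (W2, stmt-NavierStokesRegularity-27585) — LINE g11-1 «VIRIAL HORN»: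
# BRACKET INJECTIVITY IN DEGREE TWO (`bracketInjective_two`), and the bridges to the W1 polynomial calculus

Director KEY-NS #210 (W-i) / dss_155.  The hypothesis `hinj` of `windowWedgeAnalyticL_of_bracketInjective` (p712484) — «for a linearly
independent family `B` of solid harmonics of degree `l`, `(∀ y, Σ_{m,m′} w_{mm′} {B_m,B_{m′}}(y) = 0) → w` symmetric» — PROVED for `l = 2`
(statement = that binder with `l` fixed, verbatim; degree one is ns-crc-p1's `ThreadingJets.bracketInjective_one`, p715311).  Route: the frame
reduction `bracketInjective_of_frame` (file `…BracketFrame`) with the polynomial frame `X₀X₁, X₀X₂, X₁X₂, X₀²−X₁², X₀²−X₂²` (a basis of the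
trace-free quadratic forms); the frame statement is a finite evaluation certificate (10 integer points; exact rational dual vectors fed to
`linear_combination`); the span statement is `exists_quadY_of_isHomogeneous_two` + `lap3_quadY` (trace zero).  Bridges to
the polynomial calculus of the W1 cell (`PoloidalLiouville.HorizonTower.Zonal`, ns-wall): `pbr_evalE` (`{p,q} = detP p q` on polynomial functions),
`lap3_evalE` (`lap3 = lapP`), `IsSolidHarmonic.exists_evalE` / `isSolidHarmonic_evalE`, and the antisymmetric reduction `sum_pbr_eq_sum_lt`.

HONEST LABEL: finite-dimensional algebra discharging the hypothesis `hinj` of bridge W AT DEGREE 2 ONLY; bridge W as typed (all degrees),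
`UnthreadedRigidity` (27585), W2 and NS regularity remain OPEN; nothing here is a statement about Navier–Stokes solutions.
`--supports stmt-NavierStokesRegularity-27585` (helper); ns-crc-p2 g9; 0 kit.  [folklore]
-/

-- the summit and its single sub-problem share the name (CONVENTIONS §1)
set_option linter.dupNamespace false

namespace Summit.NavierStokesRegularity.NavierStokesRegularity.Theorems.UnthreadedRigidity.VirialHorn

open scoped Topology
open Filter Set MvPolynomial
open Summit.NavierStokesRegularity.NavierStokesRegularity.Theorems.UnthreadedRigidity.ProfileHorn (E3 quadY)
open Summit.NavierStokesRegularity.NavierStokesRegularity.Theorems.PoloidalLiouville.HorizonTower (Zonal.evalE Zonal.detP Zonal.lapP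
  Zonal.gradient_evalE_apply Zonal.differentiable_evalE Zonal.fderiv_evalE_apply)

/-! ## Bridges to the polynomial calculus (`Zonal.evalE`) -/

/-- the bracket of two polynomial functions is the polynomial triple product: `{p, q}(y) = (detP p q)(y)`. -/
theorem pbr_evalE (p q : MvPolynomial (Fin 3) ℝ) (y : E3) :
    pbr (Zonal.evalE p) (Zonal.evalE q) y = Zonal.evalE (Zonal.detP p q) y := by
  unfold pbr det3
  simp only [Zonal.gradient_evalE_apply]
  simp [Zonal.detP, Zonal.evalE]
  ring

/-- `lap3` of a polynomial function is the polynomial Laplacian: `lap3 (evalE p) = evalE (lapP p)`. -/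
theorem lap3_evalE (p : MvPolynomial (Fin 3) ℝ) (y : E3) : lap3 (Zonal.evalE p) y = Zonal.evalE (Zonal.lapP p) y := by
  have hdir : ∀ (q : MvPolynomial (Fin 3) ℝ) (i : Fin 3),
      (fun z : E3 => fderiv ℝ (Zonal.evalE q) z (e i)) = Zonal.evalE (pderiv i q) := by
    intro q i
    funext z
    rw [Zonal.fderiv_evalE_apply, Fin.sum_univ_three]
    fin_cases i <;> simp [e]
  unfold lap3 dir2
  simp only [hdir]
  rw [Fin.sum_univ_three]
  simp only [Zonal.fderiv_evalE_apply, Fin.sum_univ_three]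
  simp [e, Zonal.lapP]

/-- a solid harmonic in the sense of the VIRIAL HORN file is a homogeneous polynomial with `lapP = 0`, as a function `evalE`. -/
theorem IsSolidHarmonic.exists_evalE {l : ℕ} {Y : E3 → ℝ} (hY : IsSolidHarmonic l Y) :
    ∃ P : MvPolynomial (Fin 3) ℝ, P.IsHomogeneous l ∧ Zonal.lapP P = 0 ∧ Y = Zonal.evalE P := by
  obtain ⟨⟨P, hPh, hPe⟩, hlap⟩ := hY
  have hYP : Y = Zonal.evalE P := funext fun y => hPe y
  refine ⟨P, hPh, ?_, hYP⟩
  apply Summit.NavierStokesRegularity.NavierStokesRegularity.Theorems.PoloidalLiouville.HorizonTower.Zonal.eq_zero_of_evalE_eq_zero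
  intro y
  rw [← lap3_evalE, ← hYP]
  exact hlap y

/-- conversely, a homogeneous polynomial of degree `l` with `lapP = 0` defines a solid harmonic of degree `l`. -/
theorem isSolidHarmonic_evalE {l : ℕ} {P : MvPolynomial (Fin 3) ℝ} (hPh : P.IsHomogeneous l) (hlap : Zonal.lapP P = 0) :
    IsSolidHarmonic l (Zonal.evalE P) := by
  refine ⟨⟨P, hPh, fun y => rfl⟩, fun y => ?_⟩
  rw [lap3_evalE, hlap]
  simp [Zonal.evalE]

/-! ## The antisymmetric reduction of a bracket sum -/

/-- `Σ_{i,j} a_{ij} {F_i,F_j} = Σ_{i<j} (a_{ij} − a_{ji}) {F_i,F_j}` (antisymmetry of the bracket). -/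
theorem sum_pbr_eq_sum_lt {d : ℕ} (F : Fin d → E3 → ℝ) (a : Fin d → Fin d → ℝ) (y : E3) :
    ∑ i, ∑ j, a i j * pbr (F i) (F j) y = ∑ i, ∑ j, (if i < j then (a i j - a j i) * pbr (F i) (F j) y else 0) := by
  have hsplit : ∀ i j, a i j * pbr (F i) (F j) y
      = (if i < j then a i j * pbr (F i) (F j) y else 0) + (if j < i then a i j * pbr (F i) (F j) y else 0) := by
    intro i j
    rcases lt_trichotomy i j with h | h | h
    · rw [if_pos h, if_neg (not_lt.mpr h.le), add_zero]
    · subst h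
      rw [if_neg (lt_irrefl i), pbr_self, mul_zero, add_zero]
    · rw [if_neg (not_lt.mpr h.le), if_pos h, zero_add]
  have hswap : ∑ i, ∑ j, (if j < i then a i j * pbr (F i) (F j) y else 0)
      = ∑ i, ∑ j, (if i < j then -(a j i * pbr (F i) (F j) y) else 0) := by
    rw [Finset.sum_comm]
    refine Finset.sum_congr rfl fun i _ => Finset.sum_congr rfl fun j _ => ?_
    by_cases h : i < j
    · rw [if_pos h, if_pos h, pbr_swap (F j) (F i) y]
      ring
    · rw [if_neg h, if_neg h]
  rw [Finset.sum_congr rfl fun i _ => Finset.sum_congr rfl fun j _ => hsplit i j]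
  simp only [Finset.sum_add_distrib]
  rw [hswap, ← Finset.sum_add_distrib]
  refine Finset.sum_congr rfl fun i _ => ?_
  rw [← Finset.sum_add_distrib]
  refine Finset.sum_congr rfl fun j _ => ?_
  by_cases h : i < j
  · rw [if_pos h, if_pos h, if_pos h]
    ring
  · rw [if_neg h, if_neg h, if_neg h, add_zero]

/-! ## Degree two -/

/-! ### Degree two: the 10 brackets of the frame in closed form -/

/-- closed form of the bracket of frame elements 0 and 1 (degree two). -/
theorem pbr_frame_two_0_1 (y : E3) :
    pbr (Zonal.evalE (X 0 * X 1 : MvPolynomial (Fin 3) ℝ)) (Zonal.evalE (X 0 * X 2 : MvPolynomial (Fin 3) ℝ)) y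
      = y 0 ^ 3 + -(y 0 * y 1 ^ 2) + -(y 0 * y 2 ^ 2) := by
  rw [pbr_evalE]
  simp [Zonal.detP, Zonal.evalE]
  ring

/-- closed form of the bracket of frame elements 0 and 2 (degree two). -/
theorem pbr_frame_two_0_2 (y : E3) :
    pbr (Zonal.evalE (X 0 * X 1 : MvPolynomial (Fin 3) ℝ)) (Zonal.evalE (X 1 * X 2 : MvPolynomial (Fin 3) ℝ)) y
      = y 0 ^ 2 * y 1 + -(y 1 ^ 3) + y 1 * y 2 ^ 2 := by
  rw [pbr_evalE]
  simp [Zonal.detP, Zonal.evalE]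
  ring

/-- closed form of the bracket of frame elements 0 and 3 (degree two). -/
theorem pbr_frame_two_0_3 (y : E3) :
    pbr (Zonal.evalE (X 0 * X 1 : MvPolynomial (Fin 3) ℝ)) (Zonal.evalE (X 0 ^ 2 - X 1 ^ 2 : MvPolynomial (Fin 3) ℝ)) y
      = (-2) * y 0 ^ 2 * y 2 + (-2) * y 1 ^ 2 * y 2 := by
  rw [pbr_evalE]
  simp [Zonal.detP, Zonal.evalE]
  ring

/-- closed form of the bracket of frame elements 0 and 4 (degree two). -/
theorem pbr_frame_two_0_4 (y : E3) :
    pbr (Zonal.evalE (X 0 * X 1 : MvPolynomial (Fin 3) ℝ)) (Zonal.evalE (X 0 ^ 2 - X 2 ^ 2 : MvPolynomial (Fin 3) ℝ)) y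
      = (-4) * y 0 ^ 2 * y 2 + 2 * y 1 ^ 2 * y 2 := by
  rw [pbr_evalE]
  simp [Zonal.detP, Zonal.evalE]
  ring

/-- closed form of the bracket of frame elements 1 and 2 (degree two). -/
theorem pbr_frame_two_1_2 (y : E3) :
    pbr (Zonal.evalE (X 0 * X 2 : MvPolynomial (Fin 3) ℝ)) (Zonal.evalE (X 1 * X 2 : MvPolynomial (Fin 3) ℝ)) y
      = -(y 0 ^ 2 * y 2) + -(y 1 ^ 2 * y 2) + y 2 ^ 3 := by
  rw [pbr_evalE]
  simp [Zonal.detP, Zonal.evalE]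
  ring

/-- closed form of the bracket of frame elements 1 and 3 (degree two). -/
theorem pbr_frame_two_1_3 (y : E3) :
    pbr (Zonal.evalE (X 0 * X 2 : MvPolynomial (Fin 3) ℝ)) (Zonal.evalE (X 0 ^ 2 - X 1 ^ 2 : MvPolynomial (Fin 3) ℝ)) y
      = 4 * y 0 ^ 2 * y 1 + (-2) * y 1 * y 2 ^ 2 := by
  rw [pbr_evalE]
  simp [Zonal.detP, Zonal.evalE]
  ring

/-- closed form of the bracket of frame elements 1 and 4 (degree two). -/
theorem pbr_frame_two_1_4 (y : E3) :
    pbr (Zonal.evalE (X 0 * X 2 : MvPolynomial (Fin 3) ℝ)) (Zonal.evalE (X 0 ^ 2 - X 2 ^ 2 : MvPolynomial (Fin 3) ℝ)) y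
      = 2 * y 0 ^ 2 * y 1 + 2 * y 1 * y 2 ^ 2 := by
  rw [pbr_evalE]
  simp [Zonal.detP, Zonal.evalE]
  ring

/-- closed form of the bracket of frame elements 2 and 3 (degree two). -/
theorem pbr_frame_two_2_3 (y : E3) :
    pbr (Zonal.evalE (X 1 * X 2 : MvPolynomial (Fin 3) ℝ)) (Zonal.evalE (X 0 ^ 2 - X 1 ^ 2 : MvPolynomial (Fin 3) ℝ)) y
      = 4 * y 0 * y 1 ^ 2 + (-2) * y 0 * y 2 ^ 2 := by
  rw [pbr_evalE]
  simp [Zonal.detP, Zonal.evalE]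
  ring

/-- closed form of the bracket of frame elements 2 and 4 (degree two). -/
theorem pbr_frame_two_2_4 (y : E3) :
    pbr (Zonal.evalE (X 1 * X 2 : MvPolynomial (Fin 3) ℝ)) (Zonal.evalE (X 0 ^ 2 - X 2 ^ 2 : MvPolynomial (Fin 3) ℝ)) y
      = 2 * y 0 * y 1 ^ 2 + (-4) * y 0 * y 2 ^ 2 := by
  rw [pbr_evalE]
  simp [Zonal.detP, Zonal.evalE]
  ring

/-- closed form of the bracket of frame elements 3 and 4 (degree two). -/
theorem pbr_frame_two_3_4 (y : E3) :
    pbr (Zonal.evalE (X 0 ^ 2 - X 1 ^ 2 : MvPolynomial (Fin 3) ℝ)) (Zonal.evalE (X 0 ^ 2 - X 2 ^ 2 : MvPolynomial (Fin 3) ℝ)) y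
      = 12 * y 0 * y 1 * y 2 := by
  rw [pbr_evalE]
  simp [Zonal.detP, Zonal.evalE]
  ring

/-- FRAME STATEMENT, DEGREE TWO: the 10 brackets of the frame are injective on coefficient arrays (they are linearly
independent).  Certificate: 10 integer evaluation points and the exact rational dual vectors (`linear_combination`). -/
theorem frame_two (a : Fin 5 → Fin 5 → ℝ)
    (ha : ∀ y : E3, ∑ i, ∑ j, a i j * pbr (Zonal.evalE (((![X 0 * X 1, X 0 * X 2, X 1 * X 2, X 0 ^ 2 - X 1 ^ 2, X 0 ^ 2 - X 2 ^ 2] : Fin 5 → MvPolynomial (Fin 3) ℝ)) i)) (Zonal.evalE (((![X 0 * X 1, X 0 * X 2, X 1 * X 2, X 0 ^ 2 - X 1 ^ 2, X 0 ^ 2 - X 2 ^ 2] : Fin 5 → MvPolynomial (Fin 3) ℝ)) j)) y = 0) :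
    ∀ i j, a i j = a j i := by
  have key : ∀ y : E3, ∑ i, ∑ j, (if i < j then (a i j - a j i) *
      pbr (Zonal.evalE (((![X 0 * X 1, X 0 * X 2, X 1 * X 2, X 0 ^ 2 - X 1 ^ 2, X 0 ^ 2 - X 2 ^ 2] : Fin 5 → MvPolynomial (Fin 3) ℝ)) i)) (Zonal.evalE (((![X 0 * X 1, X 0 * X 2, X 1 * X 2, X 0 ^ 2 - X 1 ^ 2, X 0 ^ 2 - X 2 ^ 2] : Fin 5 → MvPolynomial (Fin 3) ℝ)) j)) y else 0) = 0 := fun y => by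
    rw [← sum_pbr_eq_sum_lt]; exact ha y
  have key2 : ∀ y : E3, (a 0 1 - a 1 0) * (y 0 ^ 3 + -(y 0 * y 1 ^ 2) + -(y 0 * y 2 ^ 2)) + (a 0 2 - a 2 0) * (y 0 ^ 2 * y 1 + -(y 1 ^ 3) + y 1 * y 2 ^ 2) + (a 0 3 - a 3 0) * ((-2) * y 0 ^ 2 * y 2 + (-2) * y 1 ^ 2 * y 2) + (a 0 4 - a 4 0) * ((-4) * y 0 ^ 2 * y 2 + 2 * y 1 ^ 2 * y 2) + (a 1 2 - a 2 1) * (-(y 0 ^ 2 * y 2) + -(y 1 ^ 2 * y 2) + y 2 ^ 3) + (a 1 3 - a 3 1) * (4 * y 0 ^ 2 * y 1 + (-2) * y 1 * y 2 ^ 2) + (a 1 4 - a 4 1) * (2 * y 0 ^ 2 * y 1 + 2 * y 1 * y 2 ^ 2) + (a 2 3 - a 3 2) * (4 * y 0 * y 1 ^ 2 + (-2) * y 0 * y 2 ^ 2) + (a 2 4 - a 4 2) * (2 * y 0 * y 1 ^ 2 + (-4) * y 0 * y 2 ^ 2) + (a 3 4 - a 4 3) * (12 * y 0 * y 1 * y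 2) = 0 := fun y => by
    have h := key y
    simp only [Fin.sum_univ_five, Fin.isValue, Fin.reduceLT, if_true, if_false, add_zero, zero_add, Matrix.cons_val_zero,
      Matrix.cons_val_one, Matrix.cons_val] at h
    simp only [pbr_frame_two_0_1, pbr_frame_two_0_2, pbr_frame_two_0_3, pbr_frame_two_0_4, pbr_frame_two_1_2, pbr_frame_two_1_3, pbr_frame_two_1_4, pbr_frame_two_2_3, pbr_frame_two_2_4, pbr_frame_two_3_4] at h
    linear_combination h
  have h0 : (1 : ℝ) * (a 1 2 - a 2 1) = 0 := by
    have h := key2 (WithLp.toLp 2 ![0, 0, 1])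
    simp only [Matrix.cons_val_zero, Matrix.cons_val_one, Matrix.cons_val_two, Matrix.head_cons, Matrix.tail_cons] at h
    norm_num at h
    linarith only [h]
  have h1 : (-1 : ℝ) * (a 0 2 - a 2 0) = 0 := by
    have h := key2 (WithLp.toLp 2 ![0, 1, 0])
    simp only [Matrix.cons_val_zero, Matrix.cons_val_one, Matrix.cons_val_two, Matrix.head_cons, Matrix.tail_cons] at h
    norm_num at h
    linarith only [h]
  have h2 : (1 : ℝ) * (a 0 1 - a 1 0) = 0 := by
    have h := key2 (WithLp.toLp 2 ![1, 0, 0])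
    simp only [Matrix.cons_val_zero, Matrix.cons_val_one, Matrix.cons_val_two, Matrix.head_cons, Matrix.tail_cons] at h
    norm_num at h
    linarith only [h]
  have h3 : (-2 : ℝ) * (a 0 3 - a 3 0) + (2 : ℝ) * (a 0 4 - a 4 0) + (-2 : ℝ) * (a 1 3 - a 3 1) + (2 : ℝ) * (a 1 4 - a 4 1) = 0 := by
    have h := key2 (WithLp.toLp 2 ![0, 1, 1])
    simp only [Matrix.cons_val_zero, Matrix.cons_val_one, Matrix.cons_val_two, Matrix.head_cons, Matrix.tail_cons] at h
    norm_num at h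
    linarith only [h]
  have h4 : (-2 : ℝ) * (a 0 3 - a 3 0) + (-4 : ℝ) * (a 0 4 - a 4 0) + (-2 : ℝ) * (a 2 3 - a 3 2) + (-4 : ℝ) * (a 2 4 - a 4 2) = 0 := by
    have h := key2 (WithLp.toLp 2 ![1, 0, 1])
    simp only [Matrix.cons_val_zero, Matrix.cons_val_one, Matrix.cons_val_two, Matrix.head_cons, Matrix.tail_cons] at h
    norm_num at h
    linarith only [h]
  have h5 : (4 : ℝ) * (a 1 3 - a 3 1) + (2 : ℝ) * (a 1 4 - a 4 1) + (4 : ℝ) * (a 2 3 - a 3 2) + (2 : ℝ) * (a 2 4 - a 4 2) = 0 := by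
    have h := key2 (WithLp.toLp 2 ![1, 1, 0])
    simp only [Matrix.cons_val_zero, Matrix.cons_val_one, Matrix.cons_val_two, Matrix.head_cons, Matrix.tail_cons] at h
    norm_num at h
    linarith only [h]
  have h6 : (3 : ℝ) * (a 0 2 - a 2 0) + (-4 : ℝ) * (a 0 3 - a 3 0) + (4 : ℝ) * (a 0 4 - a 4 0) + (6 : ℝ) * (a 1 2 - a 2 1) + (-8 : ℝ) * (a 1 3 - a 3 1) + (8 : ℝ) * (a 1 4 - a 4 1) = 0 := by
    have h := key2 (WithLp.toLp 2 ![0, 1, 2])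
    simp only [Matrix.cons_val_zero, Matrix.cons_val_one, Matrix.cons_val_two, Matrix.head_cons, Matrix.tail_cons] at h
    norm_num at h
    linarith only [h]
  have h7 : (-3 : ℝ) * (a 0 1 - a 1 0) + (-4 : ℝ) * (a 0 3 - a 3 0) + (-8 : ℝ) * (a 0 4 - a 4 0) + (6 : ℝ) * (a 1 2 - a 2 1) + (-8 : ℝ) * (a 2 3 - a 3 2) + (-16 : ℝ) * (a 2 4 - a 4 2) = 0 := by
    have h := key2 (WithLp.toLp 2 ![1, 0, 2])
    simp only [Matrix.cons_val_zero, Matrix.cons_val_one, Matrix.cons_val_two, Matrix.head_cons, Matrix.tail_cons] at h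
    norm_num at h
    linarith only [h]
  have h8 : (-3 : ℝ) * (a 0 1 - a 1 0) + (-6 : ℝ) * (a 0 2 - a 2 0) + (8 : ℝ) * (a 1 3 - a 3 1) + (4 : ℝ) * (a 1 4 - a 4 1) + (16 : ℝ) * (a 2 3 - a 3 2) + (8 : ℝ) * (a 2 4 - a 4 2) = 0 := by
    have h := key2 (WithLp.toLp 2 ![1, 2, 0])
    simp only [Matrix.cons_val_zero, Matrix.cons_val_one, Matrix.cons_val_two, Matrix.head_cons, Matrix.tail_cons] at h
    norm_num at h
    linarith only [h]
  have h9 : (-1 : ℝ) * (a 0 1 - a 1 0) + (1 : ℝ) * (a 0 2 - a 2 0) + (-4 : ℝ) * (a 0 3 - a 3 0) + (-2 : ℝ) * (a 0 4 - a 4 0) + (-1 : ℝ) * (a 1 2 - a 2 1) + (2 : ℝ) * (a 1 3 - a 3 1) + (4 : ℝ) * (a 1 4 - a 4 1) + (2 : ℝ) * (a 2 3 - a 3 2) + (-2 : ℝ) * (a 2 4 - a 4 2) + (12 : ℝ) * (a 3 4 - a 4 3) = 0 := by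
    have h := key2 (WithLp.toLp 2 ![1, 1, 1])
    simp only [Matrix.cons_val_zero, Matrix.cons_val_one, Matrix.cons_val_two, Matrix.head_cons, Matrix.tail_cons] at h
    norm_num at h
    linarith only [h]
  have e_0_1 : a 0 1 - a 1 0 = 0 := by linear_combination (1 : ℝ) * h2
  have e_0_2 : a 0 2 - a 2 0 = 0 := by linear_combination (-1 : ℝ) * h1
  have e_0_3 : a 0 3 - a 3 0 = 0 := by linear_combination ((-3 : ℝ) / 2) * h0 + ((1 : ℝ) / 2) * h1 + ((1 : ℝ) / 4) * h2 + ((-2 : ℝ) / 3) * h3 + ((-1 : ℝ) / 3) * h4 + ((1 : ℝ) / 6) * h6 + ((1 : ℝ) / 12) * h7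
  have e_0_4 : a 0 4 - a 4 0 = 0 := by linear_combination ((-1 : ℝ) / 4) * h1 + ((1 : ℝ) / 4) * h2 + ((1 : ℝ) / 3) * h3 + ((-1 : ℝ) / 3) * h4 + ((-1 : ℝ) / 12) * h6 + ((1 : ℝ) / 12) * h7
  have e_1_2 : a 1 2 - a 2 1 = 0 := by linear_combination (1 : ℝ) * h0
  have e_1_3 : a 1 3 - a 3 1 = 0 := by linear_combination ((1 : ℝ) / 2) * h0 + ((1 : ℝ) / 4) * h1 + ((-1 : ℝ) / 4) * h2 + ((1 : ℝ) / 6) * h3 + ((1 : ℝ) / 3) * h5 + ((-1 : ℝ) / 12) * h6 + ((-1 : ℝ) / 12) * h8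
  have e_1_4 : a 1 4 - a 4 1 = 0 := by linear_combination (-1 : ℝ) * h0 + (1 : ℝ) * h1 + ((-1 : ℝ) / 4) * h2 + ((-1 : ℝ) / 3) * h3 + ((1 : ℝ) / 3) * h5 + ((1 : ℝ) / 6) * h6 + ((-1 : ℝ) / 12) * h8
  have e_2_3 : a 2 3 - a 3 2 = 0 := by linear_combination ((-1 : ℝ) / 2) * h0 + (-1 : ℝ) * h1 + ((3 : ℝ) / 4) * h2 + ((-1 : ℝ) / 6) * h4 + ((-1 : ℝ) / 3) * h5 + ((1 : ℝ) / 12) * h7 + ((1 : ℝ) / 6) * h8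
  have e_2_4 : a 2 4 - a 4 2 = 0 := by linear_combination (1 : ℝ) * h0 + ((1 : ℝ) / 2) * h1 + ((-3 : ℝ) / 4) * h2 + ((1 : ℝ) / 3) * h4 + ((1 : ℝ) / 6) * h5 + ((-1 : ℝ) / 6) * h7 + ((-1 : ℝ) / 12) * h8
  have e_3_4 : a 3 4 - a 4 3 = 0 := by linear_combination ((1 : ℝ) / 12) * h0 + ((1 : ℝ) / 12) * h1 + ((1 : ℝ) / 12) * h2 + ((-1 : ℝ) / 12) * h3 + ((-1 : ℝ) / 12) * h4 + ((-1 : ℝ) / 12) * h5 + ((1 : ℝ) / 12) * h9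
  clear key key2 h0 h1 h2 h3 h4 h5 h6 h7 h8 h9
  intro i j
  fin_cases i <;> fin_cases j
  all_goals simp only [Fin.zero_eta, Fin.mk_one, Fin.reduceFinMk]
  all_goals linarith only [e_0_1, e_0_2, e_0_3, e_0_4, e_1_2, e_1_3, e_1_4, e_2_3, e_2_4, e_3_4]

/-- SPAN STATEMENT, DEGREE TWO: a solid harmonic of degree two is a combination of the five trace-free forms
(`Y = Y_Q`, `Q` symmetric with `tr Q = 0` by `lap3_quadY`). -/
theorem span_two {Y : E3 → ℝ} (hY : IsSolidHarmonic 2 Y) :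
    ∃ c : Fin 5 → ℝ, ∀ y : E3, Y y = ∑ k, c k * Zonal.evalE ((![X 0 * X 1, X 0 * X 2, X 1 * X 2, X 0 ^ 2 - X 1 ^ 2, X 0 ^ 2 - X 2 ^ 2] : Fin 5 → MvPolynomial (Fin 3) ℝ) k) y := by
  obtain ⟨⟨P, hPh, hPe⟩, hlap⟩ := hY
  obtain ⟨Q, hQs, hQe⟩ := exists_quadY_of_isHomogeneous_two P hPh
  have hYQ : Y = quadY Q := funext fun y => by rw [hPe y, hQe y]
  have htr : Q 0 0 + Q 1 1 + Q 2 2 = 0 := by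
    have h0 := hlap 0
    rw [hYQ, lap3_quadY] at h0
    linarith only [h0]
  have hs : ∀ i j : Fin 3, Q j i = Q i j := fun i j => by
    have := congrFun (congrFun hQs i) j
    simpa [Matrix.transpose_apply] using this
  refine ⟨![2 * Q 0 1, 2 * Q 0 2, 2 * Q 1 2, -Q 1 1, -Q 2 2], fun y => ?_⟩
  have h1 : quadY Q y = Q 0 0 * y 0 ^ 2 + Q 1 1 * y 1 ^ 2 + Q 2 2 * y 2 ^ 2 + (Q 0 1 + Q 1 0) * y 0 * y 1
      + (Q 0 2 + Q 2 0) * y 0 * y 2 + (Q 1 2 + Q 2 1) * y 1 * y 2 := by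
    simp only [quadY, Fin.sum_univ_three]
    ring
  rw [hYQ, h1, Fin.sum_univ_five]
  simp [Zonal.evalE]
  linear_combination (y 0 * y 1) * hs 0 1 + (y 0 * y 2) * hs 0 2 + (y 1 * y 2) * hs 1 2 + (y 0 ^ 2) * htr

/-- ★ **BRACKET INJECTIVITY IN DEGREE TWO** (`hinj` of `windowWedgeAnalyticL_of_bracketInjective` at `l = 2`): for every linearly independent
family `B` of solid harmonics of degree two, `(∀ y, Σ_{m,m′} w_{mm′} {B_m,B_{m′}}(y) = 0) → w` symmetric. -/
theorem bracketInjective_two : ∀ (n : ℕ) (B : Fin n → E3 → ℝ), (∀ m, IsSolidHarmonic 2 (B m)) → LinearIndependent ℝ B →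
    ∀ w : Fin n → Fin n → ℝ, (∀ y : E3, ∑ m, ∑ m', w m m' * pbr (B m) (B m') y = 0) → ∀ m m', w m m' = w m' m := by
  intro n B hB hli w hw
  choose Cf hCf using fun m => span_two (hB m)
  exact bracketInjective_of_frame (fun k => Zonal.evalE ((![X 0 * X 1, X 0 * X 2, X 1 * X 2, X 0 ^ 2 - X 1 ^ 2, X 0 ^ 2 - X 2 ^ 2] : Fin 5 → MvPolynomial (Fin 3) ℝ) k))
    (fun k => Zonal.differentiable_evalE _) frame_two hli Cf hCf w hw

end Summit.NavierStokesRegularity.NavierStokesRegularity.Theorems.UnthreadedRigidity.VirialHorn
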